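import Mathlib

/-!
Companion to `STUB-IDEAS-stub_altFixing_orbit_dichotomy-3.md` (stub-ideation k3, crux `MonotoneRestorationQP`,
item stmt-ValiantsHypothesis-15886).
Helper-lemma STATEMENTS (sorried) + the assembly `helper lemmas ⇒ stub` as a real proof term,
to certify that the proposed cut typechecks. Nothing here is proposed to the tree.
-/

namespace AltFixingSketch

open Equiv Equiv.Perm MulAction

/-- H2 — the diagonal relabelling action `x_{ab} ↦ x_{ρ a, ρ b}` of `Sym(Fin n)` on
`K[x_{ab}]` as a `MulAction` (local instance; `one_smul` = `rename_id`, `mul_smul` =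
`rename_rename`). -/
@[reducible] noncomputable def diagRenameAction (n : ℕ) (K : Type) [CommSemiring K] :
    MulAction (Perm (Fin n)) (MvPolynomial (Fin n × Fin n) K) where
  smul ρ q := MvPolynomial.rename (fun p : Fin n × Fin n => (ρ p.1, ρ p.2)) q
  one_smul q := by
    show MvPolynomial.rename _ q = q
    simp only [Perm.coe_one, id_eq, Prod.mk.eta]
    exact MvPolynomial.rename_id_apply q
  mul_smul ρ σ q := by
    show MvPolynomial.rename _ q = MvPolynomial.rename _ (MvPolynomial.rename _ q)
    rw [MvPolynomial.rename_rename]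
    rfl

attribute [local instance] diagRenameAction

theorem diag_smul_def {n : ℕ} {K : Type} [CommSemiring K] (ρ : Perm (Fin n))
    (q : MvPolynomial (Fin n × Fin n) K) :
    ρ • q = MvPolynomial.rename (fun p : Fin n × Fin n => (ρ p.1, ρ p.2)) q := rfl

/-- H1 — Jordan's index bound, the `k = 1` end of Dixon–Mortimer 5.2B: for `|β| ≥ 5` the
alternating group `Alt(β)` has no proper subgroup of index `< |β|`.
Proof plan: `N := H.normalCore`; `alternatingGroup.normal_subgroup_eq_bot_or_eq_top` gives
`N = ⊥ ∨ N = ⊤`; `⊤` ⇒ `H = ⊤` (`Subgroup.normalCore_le`); `⊥` ⇒ `N.index = |Alt β| = |β|!/2`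
(`two_mul_card_alternatingGroup`) divides `H.index !` (idiom of Mathlib
`Subgroup.normal_of_index_eq_minFac_card`: `normalCore_eq_ker, index_ker, index_eq_card,
← Nat.card_perm; card_subgroup_dvd_card (toPermHom _ _).range`) `≤ (|β|-1)!`, absurd. -/
theorem alternatingGroup_subgroup_eq_top_of_index_lt {β : Type*} [Fintype β] [DecidableEq β]
    (h5 : 5 ≤ Fintype.card β) (H : Subgroup (alternatingGroup β))
    (hH : H.index < Fintype.card β) : H = ⊤ := by
  sorry

/-- H1' — orbit form of H1: an `Alt(β)`-orbit of size `< |β|` (`|β| ≥ 5`) is a fixed point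
(`MulAction.index_stabilizer` + `Set.ncard_le_ncard` + H1 + `mem_stabilizer_iff`). -/
theorem alternatingGroup_smul_eq_self_of_orbit_subset {β γ : Type*} [Fintype β] [DecidableEq β]
    [MulAction (alternatingGroup β) γ] (h5 : 5 ≤ Fintype.card β) (q : γ) (T : Finset γ)
    (hT : T.card < Fintype.card β) (horb : ∀ g : alternatingGroup β, g • q ∈ T) :
    ∀ g : alternatingGroup β, g • q = q := by
  sorry

/-- H3a — an element of `Alt({x ∉ X})`, extended by the identity (`Perm.ofSubtype`), fixes `X`
pointwise and is even (`ofSubtype_apply_of_not_mem`, `sign_ofSubtype`). -/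
theorem ofSubtype_alternating_fix_sign {n : ℕ} (X : Finset (Fin n))
    (g : alternatingGroup {x : Fin n // x ∉ X}) :
    (∀ x ∈ X, Perm.ofSubtype (g : Perm {x : Fin n // x ∉ X}) x = x) ∧
      Perm.sign (Perm.ofSubtype (g : Perm {x : Fin n // x ∉ X})) = 1 := by
  sorry

/-- H3b — conversely every even permutation fixing `X` pointwise is such an extension
(`ρ.subtypePerm`, `sign_subtypePerm`, `ofSubtype_subtypePerm`; the invariance side condition
`ρ x ∉ X ↔ x ∉ X` is proved verbatim in `SmallIndexSubgroups.lean` (DM 5.2B, final block)). -/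
theorem exists_alternating_ofSubtype_eq {n : ℕ} (X : Finset (Fin n)) (ρ : Perm (Fin n))
    (hρ : ∀ x ∈ X, ρ x = x) (hsign : Perm.sign ρ = 1) :
    ∃ g : alternatingGroup {x : Fin n // x ∉ X},
      Perm.ofSubtype (g : Perm {x : Fin n // x ∉ X}) = ρ := by
  sorry

/-- ASSEMBLY: helper lemmas ⇒ the stub, verbatim signature of `stub_altFixing_orbit_dichotomy`. -/
theorem stub_altFixing_orbit_dichotomy {n : ℕ} {K : Type} [CommSemiring K]
    (q : MvPolynomial (Fin n × Fin n) K) (X : Finset (Fin n)) (h8 : X.card + 9 ≤ n)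
    (T : Finset (MvPolynomial (Fin n × Fin n) K)) (hT : T.card + X.card < n)
    (horb : ∀ ρ : Equiv.Perm (Fin n), (∀ x ∈ X, ρ x = x) → Equiv.Perm.sign ρ = 1 →
      MvPolynomial.rename (fun p : Fin n × Fin n => (ρ p.1, ρ p.2)) q ∈ T) :
    ∀ ρ : Equiv.Perm (Fin n), (∀ x ∈ X, ρ x = x) → Equiv.Perm.sign ρ = 1 →
      MvPolynomial.rename (fun p : Fin n × Fin n => (ρ p.1, ρ p.2)) q = q := by
  classical
  -- the alternating group of the free points acts through `ofSubtype`
  let A := alternatingGroup {x : Fin n // x ∉ X}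
  letI : MulAction A (MvPolynomial (Fin n × Fin n) K) :=
    MulAction.compHom _ ((Perm.ofSubtype : Perm {x : Fin n // x ∉ X} →* Perm (Fin n)).comp
      A.subtype)
  have hsmul : ∀ (g : A), g • q =
      MvPolynomial.rename (fun p : Fin n × Fin n =>
        (Perm.ofSubtype (g : Perm {x : Fin n // x ∉ X}) p.1,
         Perm.ofSubtype (g : Perm {x : Fin n // x ∉ X}) p.2)) q := fun g => rfl
  have hcard : Fintype.card {x : Fin n // x ∉ X} = n - X.card := by
    rw [Fintype.card_subtype_compl, Fintype.card_coe, Fintype.card_fin]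
  have h5 : 5 ≤ Fintype.card {x : Fin n // x ∉ X} := by rw [hcard]; omega
  have hT' : T.card < Fintype.card {x : Fin n // x ∉ X} := by rw [hcard]; omega
  have horb' : ∀ g : A, g • q ∈ T := fun g => by
    rw [hsmul]
    obtain ⟨hfix, hsg⟩ := ofSubtype_alternating_fix_sign X g
    exact horb _ hfix hsg
  have hfixq := alternatingGroup_smul_eq_self_of_orbit_subset h5 q T hT' horb'
  intro ρ hρ hsign
  obtain ⟨g, hg⟩ := exists_alternating_ofSubtype_eq X ρ hρ hsign
  have := hfixq g
  rw [hsmul, hg] at this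
  exact this

end AltFixingSketch
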